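import Literature.MathematicalPhysics.KineticTheory.HardSphereCanonicalClusterBound
import Literature.MathematicalPhysics.KineticTheory.CollisionFluxUpperBound
import Summits.AtomisticToContinuum.HydrodynamicLimit.Theorems.RelayRaceLocalityGibbsLightConeStubGibbsInvariance
import HarnessLib

/-!
# Stub `stub_staticNecklaceAnchor` of the line `Sketch` (log-window-tagged-tail) for the crux
`RelayRaceLocality.GibbsLightCone` (stmt-AtomisticToContinuum-12501)

Registered (non-composing) anchor of the lead prover's skeleton
(`Cruxes/GibbsLightCone/Lines/Sketch.lean`): the EQUAL-TIME shadow of the slab-contact necklace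
seam `X″` for every number of links `n` — the classical Ruelle necklace bound. For `N + 1` hard
spheres of diameter `ε_N = hsDiameter σ N` on `𝕋³` under the invariant homogeneous Gibbs law
`G_N = localGibbsLaw σ a 0 θ N Φ`, an injective label chain `q₀, …, q_n` and ONE time `t`, the
`G_N`-probability that consecutive chain particles are within minimal-image distance `r` at time `t`
is at most `(C r³)ⁿ`, with `C = 32` uniform in `N` and in `σ < σ₀`.

Proof (Ruelle 1969 §4.2 in event form):
* stationarity (`stub_gibbsInvariance`): the event at time `t` has the probability of the event at
  time `0`, which is a pure position event;
* the position marginal of `G_N` is the configurational canonical measure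
  (`localGibbsLaw_eq`, `localGibbsMeasure_preimage_pos`), of activity `1` after cancelling the
  constant activity (`posGibbsMeasure_const_eq_one`);
* the iterated insertion bound `posGibbs_le_two_pow_mul_pi`: an event involving only the `n + 1`
  labels of the chain has canonical probability `≤ 2^{n+1}` times its probability for independent
  uniform points (`SmallDensity uniformProfile σ` from `exists_smallDensity`);
* for independent uniform points the necklace event has probability `vol(B_r)ⁿ`, peeling the last
  label of the chain one at a time by translation invariance of Haar measure
  (`pi_subEvent_inter_eq`), where `B_r` is the closed minimal-image ball of radius `r`;
* `vol(B_r) ≤ (2r)³` (the minimal-image ball lies in the sup-metric ball, whose Haar measure is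
  `min(1, 2r)³`, `AddCircle.volume_closedBall`), and `2^{n+1} (8 r³)ⁿ ≤ (32 r³)ⁿ` for `n ≥ 1`;
  `n = 0` is `G_N ≤ 1` (`isProbabilityMeasure_localGibbsLaw`, `σ < 1/2` being part of
  `SmallDensity`).

References: D. Ruelle, *Statistical Mechanics: Rigorous Results* (1969), §4.2;
E. Pulvirenti, D. Tsagkarogiannis, Comm. Math. Phys. 316 (2012), §3.
-/

namespace Summit.AtomisticToContinuum.HydrodynamicLimit.Theorems.LogWindowTaggedTail

open Literature.MathematicalPhysics.KineticTheory Literature.Analysis.FluidPDE MeasureTheory Filter Set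

open scoped ENNReal

/-! ## The closed minimal-image ball of `𝕋³` and its Haar measure -/

/-- The closed minimal-image ball `{w | dist(w, 0) ≤ r}` of `𝕋³` is measurable. [folklore] -/
theorem measurableSet_euclidBall (r : ℝ) :
    MeasurableSet {w : T3 | Torus.euclidDist w 0 ≤ r} := by
  have h : {w : T3 | Torus.euclidDist w 0 ≤ r} = Torus.reprSym ⁻¹' Metric.closedBall 0 r := by
    ext w
    simp [Torus.euclidDist_eq]
  rw [h]
  exact Torus.measurable_reprSym measurableSet_closedBall

/-- The closed minimal-image ball of radius `r ≥ 0` lies in the closed sup-metric ball of the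
pi-type `UnitAddTorus (Fin 3)`: each coordinate circle distance is at most the minimal-image
distance. [folklore] -/
theorem euclidBall_subset_closedBall {r : ℝ} (hr : 0 ≤ r) :
    {w : T3 | Torus.euclidDist w 0 ≤ r} ⊆ Metric.closedBall (0 : T3) r := by
  intro w hw
  rw [Metric.mem_closedBall, dist_pi_le_iff hr]
  intro i
  rw [dist_eq_norm]
  exact (norm_apply_sub_le_euclidDist w 0 i).trans hw

/-- **Haar measure of a minimal-image ball**: `vol {w ∈ 𝕋³ | dist(w, 0) ≤ r} ≤ (2r)³` for every
`r ≥ 0` (product of three arcs of length `min(1, 2r)`). [folklore] -/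
theorem volume_euclidBall_le {r : ℝ} (hr : 0 ≤ r) :
    volume {w : T3 | Torus.euclidDist w 0 ≤ r} ≤ ENNReal.ofReal ((2 * r) ^ 3) := by
  haveI : ∀ _i : Fin 3, SigmaFinite (volume : Measure UnitAddCircle) := fun _ => inferInstance
  refine (measure_mono (euclidBall_subset_closedBall hr)).trans ?_
  rw [volume_pi, Measure.pi_closedBall (fun _ : Fin 3 => (volume : Measure UnitAddCircle)) _ hr]
  simp only [AddCircle.volume_closedBall, Finset.prod_const, Finset.card_univ, Fintype.card_fin]
  rw [ENNReal.ofReal_pow (by positivity)]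
  gcongr
  exact min_le_right _ _

/-- `dist(y − x, 0) = dist(x, y)` (translation invariance of the minimal-image distance), so that
`dist(x, y) ≤ r ↔ y − x ∈ B_r`. [folklore] -/
theorem euclidDist_sub_zero_eq (x y : T3) :
    Torus.euclidDist (y - x) 0 = Torus.euclidDist x y := by
  rw [Torus.euclidDist_comm x y, Torus.euclidDist_eq, Torus.euclidDist_eq, sub_zero]

/-! ## The necklace event for independent uniform points -/

/-- The necklace position event `{x | ∀ m < n, dist(x_{q m}, x_{q (m+1)}) ≤ r}` is measurable.
[folklore] -/
theorem measurableSet_necklace {M n : ℕ} (q : Fin (n + 1) → Fin M) (r : ℝ) :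
    MeasurableSet {x : Fin M → T3 |
      ∀ m : Fin n, Torus.euclidDist (x (q (Fin.castSucc m))) (x (q (Fin.succ m))) ≤ r} := by
  have hset : {x : Fin M → T3 |
      ∀ m : Fin n, Torus.euclidDist (x (q (Fin.castSucc m))) (x (q (Fin.succ m))) ≤ r} =
      ⋂ m : Fin n, {x | Torus.euclidDist (x (q (Fin.castSucc m))) (x (q (Fin.succ m))) ≤ r} := by
    ext x
    simp only [Set.mem_setOf_eq, Set.mem_iInter]
  rw [hset]
  exact MeasurableSet.iInter fun m =>
    measurableSet_le (continuous_euclidDist_apply _ _).measurable measurable_const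

/-- **The necklace event for independent uniform points**: for an injective chain `q₀, …, q_n`,
`ℙ^{⊗}{∀ m < n, dist(x_{q m}, x_{q (m+1)}) ≤ r} = vol(B_r)ⁿ` — peel the last label by translation
invariance of Haar measure (`pi_subEvent_inter_eq`) and induct. [folklore] -/
theorem pi_necklace_eq (M : ℕ) (r : ℝ) :
    ∀ (n : ℕ) (q : Fin (n + 1) → Fin M), Function.Injective q →
      (Measure.pi fun _ : Fin M => (volume : Measure T3))
          {x | ∀ m : Fin n, Torus.euclidDist (x (q (Fin.castSucc m))) (x (q (Fin.succ m))) ≤ r}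
        = volume {w : T3 | Torus.euclidDist w 0 ≤ r} ^ n := by
  intro n
  induction n with
  | zero =>
      intro q _
      have hset : {x : Fin M → T3 |
          ∀ m : Fin 0, Torus.euclidDist (x (q (Fin.castSucc m))) (x (q (Fin.succ m))) ≤ r} = univ := by
        ext x
        simp only [Set.mem_setOf_eq, Set.mem_univ, iff_true]
        exact fun m => m.elim0
      rw [hset, pow_zero, measure_univ]
  | succ n ih =>
      intro q hq
      -- the last label `j = q (last (n+1))` and its predecessor `i = q (castSucc (last n))`
      have hij : q (Fin.castSucc (Fin.last n)) ≠ q (Fin.last (n + 1)) := fun h =>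
        (Fin.castSucc_lt_last (Fin.last n)).ne (hq h)
      have hne : ∀ k : Fin (n + 1), q (Fin.last (n + 1)) ≠ q (Fin.castSucc k) := fun k h =>
        (Fin.castSucc_lt_last k).ne' (hq h)
      -- split the event: last link ∩ the necklace of the first `n` links
      have hset : {x : Fin M → T3 |
          ∀ m : Fin (n + 1), Torus.euclidDist (x (q (Fin.castSucc m))) (x (q (Fin.succ m))) ≤ r} =
          {x | x (q (Fin.last (n + 1))) - x (q (Fin.castSucc (Fin.last n))) ∈
              {w : T3 | Torus.euclidDist w 0 ≤ r}} ∩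
            {x | ∀ m : Fin n, Torus.euclidDist (x ((q ∘ Fin.castSucc) (Fin.castSucc m)))
              (x ((q ∘ Fin.castSucc) (Fin.succ m))) ≤ r} := by
        ext x
        simp only [Set.mem_inter_iff, Set.mem_setOf_eq, Function.comp_apply, Fin.forall_fin_succ',
          Fin.succ_castSucc, Fin.succ_last, Nat.succ_eq_add_one, euclidDist_sub_zero_eq]
        exact and_comm
      have hF : MeasurableSet {x : Fin M → T3 | ∀ m : Fin n,
          Torus.euclidDist (x ((q ∘ Fin.castSucc) (Fin.castSucc m)))
            (x ((q ∘ Fin.castSucc) (Fin.succ m))) ≤ r} :=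
        measurableSet_necklace (q ∘ Fin.castSucc) r
      have hFdep : ∀ (x : Fin M → T3) (y : T3),
          Function.update x (q (Fin.last (n + 1))) y ∈ {x : Fin M → T3 | ∀ m : Fin n,
            Torus.euclidDist (x ((q ∘ Fin.castSucc) (Fin.castSucc m)))
              (x ((q ∘ Fin.castSucc) (Fin.succ m))) ≤ r} ↔
          x ∈ {x : Fin M → T3 | ∀ m : Fin n,
            Torus.euclidDist (x ((q ∘ Fin.castSucc) (Fin.castSucc m)))
              (x ((q ∘ Fin.castSucc) (Fin.succ m))) ≤ r} := by
        intro x y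
        simp only [Set.mem_setOf_eq, Function.comp_apply, Function.update_of_ne (hne _).symm]
      rw [hset, pi_subEvent_inter_eq hij (measurableSet_euclidBall r) hF hFdep,
        ih (q ∘ Fin.castSucc) (hq.comp (Fin.castSucc_injective _)), pow_succ']

/-! ## The anchor -/

/-- EQUAL-TIME RUELLE NECKLACE ANCHOR (registered stub `stub_staticNecklaceAnchor` of the line
`Sketch` for the crux `GibbsLightCone`, stmt-AtomisticToContinuum-12501): there are `σ₀ > 0` and
`C ≥ 0` (here `C = 32`) such that for `a, θ > 0`, `0 < σ < σ₀`, every `N`, every hard-sphere flow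
`Φ`, every injective label chain `q₀, …, q_n`, every time `t` and radius `r ≥ 0`, the probability
under the invariant Gibbs law `G_N = localGibbsLaw σ a 0 θ N Φ` that at time `t` consecutive chain
particles are within minimal-image distance `r` is at most `(C r³)ⁿ`. Stationarity reduces to a
position event; its canonical probability is `≤ 2^{n+1}` times the independent one
(`posGibbs_le_two_pow_mul_pi`, Ruelle 1969 §4.2), which is `vol(B_r)ⁿ ≤ (8 r³)ⁿ`. [folklore] -/
theorem stub_staticNecklaceAnchor : ∃ σ₀ : ℝ, 0 < σ₀ ∧ ∃ C : ℝ, 0 ≤ C ∧ ∀ a θ : ℝ, 0 < a → 0 < θ → ∀ σ : ℝ, 0 < σ → σ < σ₀ → ∀ N : ℕ, ∀ Φ : HardSphereFlow (Torus.geometry (Fin 3)) (hsDiameter σ N) (N + 1), ∀ (n : ℕ) (q : Fin (n + 1) → Fin (N + 1)), Function.Injective q → ∀ t r : ℝ, 0 ≤ r → localGibbsLaw σ (fun _ => a) (fun _ => 0) (fun _ => θ) N Φ {z | ∀ m : Fin n, Torus.euclidDist ((Φ.flow t z (q (Fin.castSucc m))).1) ((Φ.flow t z (q (Fin.succ m))).1)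 ≤ r} ≤ ENNReal.ofReal ((C * r ^ 3) ^ n) := by
  obtain ⟨σ₀, hσ₀, hsmall⟩ := exists_smallDensity uniformProfile one_pos
  refine ⟨σ₀, hσ₀, 32, by norm_num, ?_⟩
  intro a θ ha hθ σ hσ hσlt N Φ n q hq t r hr
  have hsd : SmallDensity uniformProfile σ := (hsmall σ hσ hσlt).1
  have hσ2 : σ ≤ 1 / 2 := hsd.σ_lt_half.le
  cases n with
  | zero =>
      -- no link: a probability is at most `1 = (C r³)⁰`
      haveI := isProbabilityMeasure_localGibbsLaw (a₀ := fun _ => a) (u₀ := fun _ => 0)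
        (θ₀ := fun _ => θ) continuous_const continuous_const continuous_const (fun _ => ha)
        (fun _ => hθ) hσ2 N Φ
      rw [pow_zero, ENNReal.ofReal_one]
      exact prob_le_one
  | succ n =>
      -- the position event `S` and the phase-space event `A = pos⁻¹ S`
      have hS := measurableSet_necklace (M := N + 1) q r
      have hposm : Measurable (fun z : Config (N + 1) (Fin 3) T3 => fun i => (z i).1) :=
        measurable_pi_lambda _ fun i => (measurable_pi_apply i).fst
      have hA : MeasurableSet ((fun z : Config (N + 1) (Fin 3) T3 => fun i => (z i).1) ⁻¹'
          {x : Fin (N + 1) → T3 | ∀ m : Fin (n + 1),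
            Torus.euclidDist (x (q (Fin.castSucc m))) (x (q (Fin.succ m))) ≤ r}) := hposm hS
      -- stationarity: the event at time `t` has the probability of the event at time `0`
      have hflow : localGibbsLaw σ (fun _ => a) (fun _ => 0) (fun _ => θ) N Φ
          {z | ∀ m : Fin (n + 1), Torus.euclidDist ((Φ.flow t z (q (Fin.castSucc m))).1)
            ((Φ.flow t z (q (Fin.succ m))).1) ≤ r} =
          localGibbsLaw σ (fun _ => a) (fun _ => 0) (fun _ => θ) N Φ
            ((fun z : Config (N + 1) (Fin 3) T3 => fun i => (z i).1) ⁻¹'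
              {x : Fin (N + 1) → T3 | ∀ m : Fin (n + 1),
                Torus.euclidDist (x (q (Fin.castSucc m))) (x (q (Fin.succ m))) ≤ r}) := by
        calc localGibbsLaw σ (fun _ => a) (fun _ => 0) (fun _ => θ) N Φ
              {z | ∀ m : Fin (n + 1), Torus.euclidDist ((Φ.flow t z (q (Fin.castSucc m))).1)
                ((Φ.flow t z (q (Fin.succ m))).1) ≤ r}
            = localGibbsLaw σ (fun _ => a) (fun _ => 0) (fun _ => θ) N Φ ((Φ.flow t) ⁻¹'
                ((fun z : Config (N + 1) (Fin 3) T3 => fun i => (z i).1) ⁻¹'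
                  {x : Fin (N + 1) → T3 | ∀ m : Fin (n + 1),
                    Torus.euclidDist (x (q (Fin.castSucc m))) (x (q (Fin.succ m))) ≤ r})) := rfl
          _ = ((localGibbsLaw σ (fun _ => a) (fun _ => 0) (fun _ => θ) N Φ).map (Φ.flow t))
                ((fun z : Config (N + 1) (Fin 3) T3 => fun i => (z i).1) ⁻¹'
                  {x : Fin (N + 1) → T3 | ∀ m : Fin (n + 1),
                    Torus.euclidDist (x (q (Fin.castSucc m))) (x (q (Fin.succ m))) ≤ r}) :=
              (Measure.map_apply (Φ.measurable_flow t) hA).symm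
          _ = _ := by rw [stub_gibbsInvariance σ a θ N Φ t]
      rw [hflow, localGibbsLaw_eq,
        localGibbsMeasure_preimage_pos continuous_const continuous_const continuous_const
          (fun _ => ha.le) (fun _ => hθ) σ N hS,
        posGibbsMeasure_const_eq_one ha]
      -- the labels of the chain
      classical
      have hdep : ∀ x y : Fin (N + 1) → T3, (∀ b ∈ Finset.univ.image q, x b = y b) →
          (x ∈ {x : Fin (N + 1) → T3 | ∀ m : Fin (n + 1),
              Torus.euclidDist (x (q (Fin.castSucc m))) (x (q (Fin.succ m))) ≤ r} ↔
            y ∈ {x : Fin (N + 1) → T3 | ∀ m : Fin (n + 1),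
              Torus.euclidDist (x (q (Fin.castSucc m))) (x (q (Fin.succ m))) ≤ r}) := by
        intro x y hxy
        have hk : ∀ k, x (q k) = y (q k) := fun k =>
          hxy (q k) (Finset.mem_image_of_mem q (Finset.mem_univ k))
        simp only [Set.mem_setOf_eq, hk]
      have hcard : (Finset.univ.image q).card = n + 2 := by
        rw [Finset.card_image_of_injective _ hq, Finset.card_univ, Fintype.card_fin]
      -- the real-number inequality `2^{n+2} (2r)^{3(n+1)} ≤ (32 r³)^{n+1}`
      have h2 : (2 : ℝ) ^ (n + 2) ≤ 4 ^ (n + 1) := by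
        rw [show (4 : ℝ) = 2 ^ 2 by norm_num, ← pow_mul]
        exact pow_le_pow_right₀ (by norm_num) (by omega)
      have hreal : (2 : ℝ) ^ (n + 2) * ((2 * r) ^ 3) ^ (n + 1) ≤ (32 * r ^ 3) ^ (n + 1) := by
        calc (2 : ℝ) ^ (n + 2) * ((2 * r) ^ 3) ^ (n + 1)
            ≤ 4 ^ (n + 1) * ((2 * r) ^ 3) ^ (n + 1) := by gcongr
          _ = (32 * r ^ 3) ^ (n + 1) := by rw [← mul_pow]; ring
      calc posGibbsMeasure (fun _ : T3 => (1 : ℝ)) (hsDiameter σ N) (N + 1)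
            {x : Fin (N + 1) → T3 | ∀ m : Fin (n + 1),
              Torus.euclidDist (x (q (Fin.castSucc m))) (x (q (Fin.succ m))) ≤ r}
          ≤ (2 : ℝ≥0∞) ^ (Finset.univ.image q).card *
              (Measure.pi fun _ : Fin (N + 1) => (volume : Measure T3))
                {x : Fin (N + 1) → T3 | ∀ m : Fin (n + 1),
                  Torus.euclidDist (x (q (Fin.castSucc m))) (x (q (Fin.succ m))) ≤ r} :=
            posGibbs_le_two_pow_mul_pi hsd _ hS hdep
        _ = (2 : ℝ≥0∞) ^ (n + 2) * volume {w : T3 | Torus.euclidDist w 0 ≤ r} ^ (n + 1) := by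
            rw [hcard, pi_necklace_eq (N + 1) r (n + 1) q hq]
        _ ≤ (2 : ℝ≥0∞) ^ (n + 2) * ENNReal.ofReal ((2 * r) ^ 3) ^ (n + 1) := by
            gcongr
            exact volume_euclidBall_le hr
        _ = ENNReal.ofReal (2 ^ (n + 2) * ((2 * r) ^ 3) ^ (n + 1)) := by
            rw [ENNReal.ofReal_mul (by positivity),
              ENNReal.ofReal_pow (by positivity : (0 : ℝ) ≤ (2 * r) ^ 3),
              ENNReal.ofReal_pow (by norm_num : (0 : ℝ) ≤ 2), ENNReal.ofReal_ofNat]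
        _ ≤ ENNReal.ofReal ((32 * r ^ 3) ^ (n + 1)) := ENNReal.ofReal_le_ofReal hreal

end Summit.AtomisticToContinuum.HydrodynamicLimit.Theorems.LogWindowTaggedTail
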